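import Mathlib.Algebra.MvPolynomial.Funext
import Mathlib.Analysis.Complex.Basic
import Mathlib.Topology.Algebra.MvPolynomial
import Mathlib.Topology.MetricSpace.ProperSpace
import Literature.Combinatorics.StablePolynomials.Limits
import HarnessLib

/-!
# Borcea–Brändén's characterisation of stability preservers, multi-affine case: proofs

Companion of `Literature/Combinatorics/StablePolynomials/Basic.lean`, which states
Borcea–Brändén 2009, Theorem 1.1 for multi-affine polynomials (`κ = (1,…,1)`) as the named fact
`BorceaBranden2009_multiAffine_stabilityPreserver_iff`: a linear operator `T`, regarded on the
multi-affine complex polynomials in the variables `σ` (finite, nonempty), *preserves stability*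
(`T f` stable or `0` for every stable multi-affine `f`) iff either (a) `T f = α(f) P` with `α` a
linear functional and `P` stable, or (b) the symbol `G_T(z, w) = Σ_S T[z^S] w^{[n]∖S}`
(`multiAffineSymbol T`, variables `σ ⊕ σ`) is stable. This file proves it
(`BorceaBranden2009_multiAffine_stabilityPreserver_iff_holds`), following the paper
(J. Borcea, P. Brändén, Invent. Math. 177 (2009), arXiv:0809.0401):

* **Necessity** (§3 of the paper, "Proof of Necessity in Theorem 1.1"):
  `multiAffine_stabilityPreserver_necessity`. For `W ∈ Hⁿ` the multi-affine polynomial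
  `(z + W)^{[n]} = ∏ᵢ (zᵢ + Wᵢ)` is stable and `G_T(z, W) = T[(z + W)^{[n]}](z)`
  (`eval_multiAffineSymbol`). If `T[(z + W)^{[n]}] ≡ 0` for some `W ∈ Hⁿ`, Lemma 3.1
  (`exists_isUpperHalfPlaneStable_prod_add_C_mul`: `(z + W)^{[n]} + ε f` is stable for small
  `ε > 0`) shows that every `T f` is stable or `0`, and then `T` has rank `≤ 1`
  (`exists_functional_of_image_stable`, the rôle of Lemma 3.2 (ii); in the complex case this is
  elementary: `T f - c · T f₀` vanishes at a chosen point of `Hⁿ` for a suitable `c`). Otherwise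
  `T[(z + W)^{[n]}]` is stable for every `W ∈ Hⁿ`, i.e. `G_T` is stable.
* **Sufficiency** (§2.1, Lemma 2.2 via the Lieb–Sokal Lemma 2.1):
  `multiAffine_stabilityPreserver_sufficiency`. The analytic input, Lemma 1.7 (1) (specialising a
  variable at a real point gives `0` or a stable polynomial; Hurwitz's theorem), is
  `IsUpperHalfPlaneStable.specialize_of_im_nonneg` from `Limits.lean`; it is used here in the
  evaluation form `eq_zero_or_stable_of_eval_update_zero`. The Lieb–Sokal lemma together with the
  two specialisations `w := 0`, `v := 0` is `lieb_sokal_contraction` (one polynomial ring, the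
  contracted pair of variables `kw, kv` being affine); its proof is the printed one (`Q` is `0` or
  stable; `Im(P/Q) ≥ 0` and `Im(-∂Q/Q) ≥ 0` on `Hⁿ`, Remark 1.3; specialise). Lemma 2.2's "repeated
  use of Lieb–Sokal" is the induction `contractionStage_eq_zero_or_stable` over the set `I ⊆ [n]`
  of contracted indices, in the `3n` variables `(z, w, v)`, starting from the stable product
  `G_T(z, w) · v^{[n]} f(-1/v)` (we use the inversion of Lemma 1.7 (3) on `f` instead of the
  paper's derivatives `f^{(S)}(v)`; the contraction of the pair `(wᵢ, vᵢ)` extracts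
  `F₀₀ - F₁₁`, and after all `n` contractions one is left with `(-1)ⁿ T(f)(z)`,
  `multiAffineSymbol_stable_apply_multiAffine`). Multi-affine polynomials are put in coefficient
  form by `eq_multiAffine_of_isMultiAffine`.

## References

* J. Borcea, P. Brändén, *The Lee–Yang and Pólya–Schur programs. I. Linear operators preserving
  stability*, Invent. Math. 177 (2009) 541–569 (arXiv:0809.0401): §1.1 Theorem 1.1; §1.2
  Lemma 1.7, Lemma 1.8, Remark 1.3; §2.1 Lemma 2.1 (Lieb–Sokal), Lemma 2.2; §3 Lemma 3.1,
  Lemma 3.2, proof of necessity. [BorceaBranden2009]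
-/

noncomputable section

open MvPolynomial Finset
open scoped BigOperators ComplexConjugate

namespace Literature.Combinatorics.StablePolynomials

variable {σ : Type*}

/-! ### The polynomials `∏ᵢ (zᵢ + Wᵢ)` and the symbol -/

/-- `∏ᵢ (zᵢ + Wᵢ)` is multi-affine.
[cite: BorceaBranden2009, §3 (proof of necessity in Theorem 1.1)] -/
theorem isMultiAffine_prod_X_add_C [Fintype σ] [DecidableEq σ] (W : σ → ℂ) :
    IsMultiAffine (∏ i, (X i + C (W i)) : MvPolynomial σ ℂ) := by
  intro j
  refine (degreeOf_prod_le j _ _).trans ?_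
  calc ∑ i, degreeOf j (X i + C (W i) : MvPolynomial σ ℂ) ≤ ∑ i, (if j = i then 1 else 0) := by
        refine Finset.sum_le_sum fun i _ => (degreeOf_add_le j _ _).trans ?_
        rw [degreeOf_X, degreeOf_C]
        simp
    _ = 1 := by simp

/-- `∏ᵢ (zᵢ + Wᵢ)` is stable when every `Im Wᵢ > 0` (indeed when `Im Wᵢ ≥ 0`).
[cite: BorceaBranden2009, §3 (proof of necessity in Theorem 1.1)] -/
theorem isUpperHalfPlaneStable_prod_X_add_C [Fintype σ] {W : σ → ℂ} (hW : ∀ i, 0 < (W i).im) :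
    IsUpperHalfPlaneStable (∏ i, (X i + C (W i)) : MvPolynomial σ ℂ) :=
  isUpperHalfPlaneStable_prod _ fun i _ z hz h => by
    simp only [map_add, eval_X, eval_C] at h
    have := congrArg Complex.im h
    simp only [Complex.add_im, Complex.zero_im] at this
    linarith [hz i, hW i]

/-- Expansion `∏ᵢ (zᵢ + Wᵢ) = Σ_S W^{Sᶜ} z^S`. [folklore] -/
theorem prod_X_add_C_eq [Fintype σ] [DecidableEq σ] (W : σ → ℂ) :
    (∏ i, (X i + C (W i)) : MvPolynomial σ ℂ) = ∑ S : Finset σ, (∏ i ∈ Sᶜ, W i) • ∏ i ∈ S, X i := by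
  rw [Finset.prod_add]
  simp only [Finset.powerset_univ, ← Finset.compl_eq_univ_sdiff]
  refine Finset.sum_congr rfl fun S _ => ?_
  rw [smul_eq_C_mul, map_prod]
  exact mul_comm _ _

/-- **The symbol is `T[(z + w)^{[n]}]`**: evaluating `G_T = Σ_S T[z^S] w^{[n]∖S}` at `(z, w)` is
evaluating `T[∏ᵢ (zᵢ + wᵢ)]` (with `w` substituted first) at `z`.
[cite: BorceaBranden2009, §1.1 (definition of G_T) and §2.1, Lemma 2.2] -/
theorem eval_multiAffineSymbol [Fintype σ] [DecidableEq σ]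
    (T : MvPolynomial σ ℂ →ₗ[ℂ] MvPolynomial σ ℂ) (z w : σ → ℂ) :
    eval (Sum.elim z w) (multiAffineSymbol T) = eval z (T (∏ i, (X i + C (w i)))) := by
  rw [prod_X_add_C_eq, map_sum]
  simp only [map_smul, map_sum, smul_eval, multiAffineSymbol, map_mul, eval_rename, map_prod, eval_X,
    Sum.elim_inr, Sum.elim_comp_inl]
  exact Finset.sum_congr rfl fun S _ => mul_comm _ _

/-! ### Borcea–Brändén's Lemma 3.1 in the multi-affine case -/

/-- **Plenty of stable polynomials** (Borcea–Brändén 2009, Lemma 3.1, case `κ = (1,…,1)`): for a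
multi-affine `f` and `W ∈ Hⁿ`, `∏ᵢ (zᵢ + Wᵢ) + ε f` is stable for some `ε > 0`. Proof: on `Hⁿ` the
quotient `f(z) / ∏ᵢ (zᵢ + Wᵢ)` is a polynomial in the bounded quantities `uᵢ = (zᵢ + Wᵢ)⁻¹`
(`|uᵢ| ≤ 1 / Im Wᵢ`), hence bounded. [cite: BorceaBranden2009, §3, Lemma 3.1] -/
theorem exists_isUpperHalfPlaneStable_prod_add_C_mul [Fintype σ] [DecidableEq σ]
    {f : MvPolynomial σ ℂ} (hf : IsMultiAffine f) {W : σ → ℂ} (hW : ∀ i, 0 < (W i).im) :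
    ∃ ε : ℝ, 0 < ε ∧ IsUpperHalfPlaneStable (∏ i, (X i + C (W i)) + C (ε : ℂ) * f) := by
  -- the bounded reparametrisation `uᵢ = (zᵢ + Wᵢ)⁻¹`
  let φ : (σ → ℂ) → ℂ := fun u => ∑ m ∈ f.support, coeff m f *
    ((∏ i ∈ m.support, (1 - W i * u i)) * ∏ i ∈ m.supportᶜ, u i)
  have hφ : Continuous φ := by
    refine continuous_finsetSum _ fun m _ => continuous_const.mul (Continuous.mul ?_ ?_)
    · exact continuous_finsetProd _ fun i _ => continuous_const.sub (continuous_const.mul (continuous_apply i))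
    · exact continuous_finsetProd _ fun i _ => continuous_apply i
  let K : Set (σ → ℂ) := Set.pi Set.univ fun i => Metric.closedBall 0 (W i).im⁻¹
  have hK : IsCompact K := isCompact_univ_pi fun i => isCompact_closedBall _ _
  obtain ⟨B, hB⟩ := hK.exists_bound_of_continuousOn hφ.continuousOn
  have hB0 : 0 ≤ B := (norm_nonneg _).trans
    (hB 0 (Set.mem_univ_pi.2 fun i => Metric.mem_closedBall_self (inv_nonneg.2 (hW i).le)))
  refine ⟨1 / (2 * (B + 1)), by positivity, ?_⟩
  intro z hz
  have hne : ∀ i, z i + W i ≠ 0 := fun i h => by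
    have := congrArg Complex.im h
    simp only [Complex.add_im, Complex.zero_im] at this
    linarith [hz i, hW i]
  set u : σ → ℂ := fun i => (z i + W i)⁻¹ with hu_def
  have hu : u ∈ K := by
    refine Set.mem_univ_pi.2 fun i => ?_
    rw [Metric.mem_closedBall, dist_zero_right, hu_def, norm_inv]
    refine inv_anti₀ (hW i) ?_
    calc (W i).im ≤ (z i + W i).im := by simp only [Complex.add_im]; linarith [hz i]
      _ ≤ |(z i + W i).im| := le_abs_self _
      _ ≤ ‖z i + W i‖ := Complex.abs_im_le_norm _
  have hE : eval z (∏ i, (X i + C (W i)) : MvPolynomial σ ℂ) = ∏ i, (z i + W i) := by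
    simp [map_prod]
  -- the identity `f(z) = (∏ᵢ (zᵢ + Wᵢ)) · φ(u)`
  have hf_eq : eval z f = (∏ i, (z i + W i)) * φ u := by
    rw [eval_eq]
    simp only [φ, Finset.mul_sum]
    refine Finset.sum_congr rfl fun m hm => ?_
    have hm1 : ∀ i ∈ m.support, m i = 1 := fun i hi =>
      le_antisymm ((isMultiAffine_iff_support f).1 hf m hm i)
        (Nat.one_le_iff_ne_zero.2 (Finsupp.mem_support_iff.1 hi))
    rw [Finset.prod_congr rfl fun i hi => by rw [hm1 i hi, pow_one]]
    have h1 : ∀ i, (z i + W i) * (1 - W i * u i) = z i := fun i => by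
      rw [hu_def]
      field_simp [hne i]
      ring
    have h2 : ∀ i, (z i + W i) * u i = 1 := fun i => mul_inv_cancel₀ (hne i)
    calc coeff m f * ∏ i ∈ m.support, z i
        = coeff m f * ((∏ i ∈ m.support, (z i + W i) * (1 - W i * u i)) *
            ∏ i ∈ m.supportᶜ, (z i + W i) * u i) := by
          simp_rw [h1, h2]
          simp
      _ = (∏ i, (z i + W i)) * (coeff m f *
            ((∏ i ∈ m.support, (1 - W i * u i)) * ∏ i ∈ m.supportᶜ, u i)) := by
          rw [Finset.prod_mul_distrib, Finset.prod_mul_distrib,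
            ← Finset.prod_mul_prod_compl m.support fun i => z i + W i]
          ring
  rw [map_add, map_mul, eval_C, hf_eq, hE]
  intro h
  have hprod : (∏ i, (z i + W i)) ≠ 0 := Finset.prod_ne_zero_iff.2 fun i _ => hne i
  have h' : (∏ i, (z i + W i)) * (1 + ((1 / (2 * (B + 1)) : ℝ) : ℂ) * φ u) = 0 := by
    rw [← h]; ring
  rcases mul_eq_zero.1 h' with h0 | h0
  · exact hprod h0
  · have hnorm : ‖((1 / (2 * (B + 1)) : ℝ) : ℂ) * φ u‖ < 1 := by
      rw [norm_mul, Complex.norm_real, Real.norm_eq_abs, abs_of_pos (by positivity)]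
      calc 1 / (2 * (B + 1)) * ‖φ u‖ ≤ 1 / (2 * (B + 1)) * B := by gcongr; exact hB u hu
        _ < 1 := by
          rw [div_mul_eq_mul_div, one_mul, div_lt_one (by positivity)]
          linarith
    have h1 : (1 : ℂ) = -(((1 / (2 * (B + 1)) : ℝ) : ℂ) * φ u) := by linear_combination h0
    have := congrArg norm h1
    rw [norm_neg, norm_one] at this
    linarith

/-! ### Rank at most one (Borcea–Brändén's Lemma 3.2 (ii)) and the necessity half -/

/-- **Images all stable ⇒ rank ≤ 1** (the rôle of Borcea–Brändén 2009, Lemma 3.2 (ii): a complex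
linear space of polynomials all of whose nonzero elements are stable has dimension `≤ 1`; here in
the operator form used in the proof of Theorem 1.1). The complex case is elementary: if
`P = T f₀ ≠ 0` and `z₀ ∈ Hⁿ`, then `T f - (T f)(z₀)/P(z₀) · P = T(f - c f₀)` vanishes at `z₀`, so
it is `0`.
[cite: BorceaBranden2009, §3, Lemma 3.2 (ii) and proof of necessity in Theorem 1.1] -/
theorem exists_functional_of_image_stable [Fintype σ] [DecidableEq σ]
    (T : MvPolynomial σ ℂ →ₗ[ℂ] MvPolynomial σ ℂ)
    (himg : ∀ f, IsMultiAffine f → IsUpperHalfPlaneStable (T f) ∨ T f = 0) :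
    ∃ (α : MvPolynomial σ ℂ →ₗ[ℂ] ℂ) (P : MvPolynomial σ ℂ), IsUpperHalfPlaneStable P ∧
      ∀ f : MvPolynomial σ ℂ, IsMultiAffine f → T f = α f • P := by
  by_cases hzero : ∀ f : MvPolynomial σ ℂ, IsMultiAffine f → T f = 0
  · exact ⟨0, C 1, isUpperHalfPlaneStable_C one_ne_zero, fun f hf => by
      rw [hzero f hf, LinearMap.zero_apply, zero_smul]⟩
  push Not at hzero
  obtain ⟨f₀, hf₀, hP0⟩ := hzero
  set P := T f₀ with hPdef
  have hP : IsUpperHalfPlaneStable P := (himg f₀ hf₀).resolve_right hP0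
  let z₀ : σ → ℂ := fun _ => Complex.I
  have hz₀ : ∀ i, 0 < (z₀ i).im := fun _ => by simp [z₀]
  have hc₀ : eval z₀ P ≠ 0 := hP z₀ hz₀
  let α : MvPolynomial σ ℂ →ₗ[ℂ] ℂ :=
    (eval z₀ P)⁻¹ • ((MvPolynomial.aeval z₀).toLinearMap ∘ₗ T)
  have hα : ∀ f, α f = (eval z₀ P)⁻¹ * eval z₀ (T f) := fun f => by
    simp [α]
  refine ⟨α, P, hP, fun f hf => ?_⟩
  have hma : IsMultiAffine (f - α f • f₀) := fun j =>
    (degreeOf_sub_le j _ _).trans (max_le (hf j)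
      (by rw [smul_eq_C_mul]; exact (degreeOf_C_mul_le _ _ _).trans (hf₀ j)))
  have hTh : T (f - α f • f₀) = T f - α f • P := by rw [map_sub, map_smul]
  have hev : eval z₀ (T (f - α f • f₀)) = 0 := by
    rw [hTh, map_sub, smul_eval, hα]
    field_simp
    ring
  rcases himg _ hma with h | h
  · exact absurd hev (h z₀ hz₀)
  · rwa [hTh, sub_eq_zero] at h

/-- **Necessity in Borcea–Brändén 2009, Theorem 1.1 (multi-affine case)** (§3, proof of
necessity): if `T` preserves stability on multi-affine polynomials then either `T = α(·) P`
with `P` stable, or the symbol `G_T` is stable. If `T[(z + W)^{[n]}] ≡ 0` for some `W ∈ Hⁿ`,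
Lemma 3.1 shows every `T f` is stable or zero and Lemma 3.2 (ii) gives (a); otherwise
`T[(z + W)^{[n]}]` is stable for all `W ∈ Hⁿ`, which is (b).
[cite: BorceaBranden2009, §3, proof of necessity in Theorem 1.1] -/
theorem multiAffine_stabilityPreserver_necessity [Fintype σ] [DecidableEq σ]
    (T : MvPolynomial σ ℂ →ₗ[ℂ] MvPolynomial σ ℂ)
    (hT : ∀ f : MvPolynomial σ ℂ, IsMultiAffine f → IsUpperHalfPlaneStable f →
        IsUpperHalfPlaneStable (T f) ∨ T f = 0) :
    (∃ (α : MvPolynomial σ ℂ →ₗ[ℂ] ℂ) (P : MvPolynomial σ ℂ), IsUpperHalfPlaneStable P ∧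
          ∀ f : MvPolynomial σ ℂ, IsMultiAffine f → T f = α f • P) ∨
        IsUpperHalfPlaneStable (multiAffineSymbol T) := by
  by_cases hcase : ∃ W : σ → ℂ, (∀ i, 0 < (W i).im) ∧ T (∏ i, (X i + C (W i))) = 0
  · left
    obtain ⟨W, hW, hTW⟩ := hcase
    refine exists_functional_of_image_stable T fun f hf => ?_
    obtain ⟨ε, hε, hst⟩ := exists_isUpperHalfPlaneStable_prod_add_C_mul hf hW
    have hma : IsMultiAffine (∏ i, (X i + C (W i)) + C (ε : ℂ) * f) := fun j =>
      (degreeOf_add_le j _ _).trans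
        (max_le (isMultiAffine_prod_X_add_C W j) ((degreeOf_C_mul_le f j _).trans (hf j)))
    have hTf : T (∏ i, (X i + C (W i)) + C (ε : ℂ) * f) = (ε : ℂ) • T f := by
      rw [map_add, hTW, zero_add, ← smul_eq_C_mul, map_smul]
    have hε0 : (ε : ℂ) ≠ 0 := by exact_mod_cast hε.ne'
    rcases hT _ hma hst with h | h
    · left
      rw [hTf, smul_eq_C_mul] at h
      exact (isUpperHalfPlaneStable_mul_iff.1 h).2
    · right
      rw [hTf] at h
      exact (smul_eq_zero.1 h).resolve_left hε0
  · right
    push Not at hcase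
    intro p hp
    rw [← Sum.elim_comp_inl_inr p, eval_multiAffineSymbol]
    have hW : ∀ i, 0 < ((p ∘ Sum.inr) i).im := fun i => hp _
    rcases hT _ (isMultiAffine_prod_X_add_C _) (isUpperHalfPlaneStable_prod_X_add_C hW) with h | h
    · exact h _ fun i => hp _
    · exact absurd h (hcase _ hW)


/-! ### Sufficiency (Borcea–Brändén's Lemma 2.2): the Lieb–Sokal contraction -/

section Contraction

variable {τ : Type*} [Fintype τ] [DecidableEq τ]

/-- **Real specialisation, evaluation form** (Borcea–Brändén 2009, Lemma 1.7 (1), proved in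
`Limits.lean` as `IsUpperHalfPlaneStable.specialize_of_im_nonneg`): if `G` is `0` or stable and
`A` is the polynomial `G|_{z_k := 0}` (identified through its evaluations), then `A` is `0` or
stable. [cite: BorceaBranden2009, §1.2, Lemma 1.7 (1)] -/
theorem eq_zero_or_stable_of_eval_update_zero {G A : MvPolynomial τ ℂ} (k : τ)
    (hG : G = 0 ∨ IsUpperHalfPlaneStable G)
    (hA : ∀ z, eval (Function.update z k 0) G = eval z A) :
    A = 0 ∨ IsUpperHalfPlaneStable A := by
  have hbind : bind₁ (Function.update X k (C 0)) G = A :=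
    MvPolynomial.funext fun z => by rw [eval_bind₁_update, hA]
  rcases hG with rfl | hG
  · left
    rw [← hbind, map_zero]
  · rw [← hbind]
    exact hG.specialize_of_im_nonneg k (by simp)

omit [Fintype τ] [DecidableEq τ] in
/-- If `a + u b ≠ 0` for all `u ∈ H` and `b ≠ 0`, then `Im (a / b) ≥ 0` (Borcea–Brändén 2009,
Remark 1.3, the pointwise half of Lemma 1.8 (3) ⇔ (4)).
[cite: BorceaBranden2009, §1.2, Remark 1.3] -/
theorem im_div_nonneg_of_forall_ne_zero {a b : ℂ} (hb : b ≠ 0)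
    (h : ∀ u : ℂ, 0 < u.im → a + u * b ≠ 0) : 0 ≤ (a / b).im := by
  by_contra hlt
  push Not at hlt
  refine h (-(a / b)) (by simpa using hlt) ?_
  field_simp
  ring

omit [Fintype τ] [DecidableEq τ] in
/-- Conversely, if `b ≠ 0` and `Im (a / b) ≥ 0` then `a + u b ≠ 0` for `u ∈ H`.
[cite: BorceaBranden2009, §1.2, Remark 1.3] -/
theorem add_mul_ne_zero_of_im_div_nonneg {a b u : ℂ} (hb : b ≠ 0) (hab : 0 ≤ (a / b).im)
    (hu : 0 < u.im) : a + u * b ≠ 0 := by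
  intro h
  have hu' : u = -(a / b) := by
    field_simp
    linear_combination h
  rw [hu', Complex.neg_im] at hu
  linarith

omit [Fintype τ] [DecidableEq τ] in
/-- `u ↦ -1/u` maps `H` to `H`. [folklore] -/
theorem neg_inv_im_pos {u : ℂ} (hu : 0 < u.im) : 0 < (-u⁻¹).im := by
  have hne : u ≠ 0 := by
    rintro rfl
    simp at hu
  rw [Complex.neg_im, Complex.inv_im, neg_div, neg_neg]
  exact div_pos hu (Complex.normSq_pos.2 hne)

/-- **The Lieb–Sokal contraction** (Borcea–Brändén 2009, Lemma 2.1 with `w := 0` and then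
`v := 0`, Lemma 1.7 (1)), in evaluation form inside one polynomial ring. Let `F` be affine in the
two variables `z_{kw}`, `z_{kv}`: `F = P + z_{kw} Q`, `P = f₀₀ + z_{kv} f₀₁`, `Q = f₁₀ + z_{kv} F₁₁`
with all pieces independent of `z_{kw}`, `z_{kv}`, and let `D = f₀₀ - F₁₁` (the polynomial
`P - ∂_{kv} Q` at `z_{kw} = z_{kv} = 0`). If `F` is `0` or stable then so is `D`. Proof as printed:
`Q` is `0` or stable (invert `z_{kw}` and specialise); if stable, `Im (P/Q) ≥ 0` and
`Im (-F₁₁/Q) ≥ 0` on `Hⁿ` (the latter from `Q(…, z_{kv} - 1/u, …) ≠ 0`), so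
`P - F₁₁ + z_{kw} Q` is stable; specialise `z_{kw} := 0`, then `z_{kv} := 0`.
[cite: BorceaBranden2009, §2.1, Lemma 2.1 (Lieb–Sokal) and its proof] -/
theorem lieb_sokal_contraction {kw kv : τ}
    {F P Q F₁₁ D : MvPolynomial τ ℂ} {f₀₀ f₀₁ f₁₀ : (τ → ℂ) → ℂ}
    (hF : ∀ z, eval z F = eval z P + z kw * eval z Q)
    (hP : ∀ z, eval z P = f₀₀ z + z kv * f₀₁ z)
    (hQ : ∀ z, eval z Q = f₁₀ z + z kv * eval z F₁₁)
    (hD : ∀ z, eval z D = f₀₀ z - eval z F₁₁)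
    (hPw : ∀ z c, eval (Function.update z kw c) P = eval z P)
    (hQw : ∀ z c, eval (Function.update z kw c) Q = eval z Q)
    (hF₁₁w : ∀ z c, eval (Function.update z kw c) F₁₁ = eval z F₁₁)
    (hf₀₀v : ∀ z c, f₀₀ (Function.update z kv c) = f₀₀ z)
    (hf₀₁v : ∀ z c, f₀₁ (Function.update z kv c) = f₀₁ z)
    (hf₁₀v : ∀ z c, f₁₀ (Function.update z kv c) = f₁₀ z)
    (hF₁₁v : ∀ z c, eval (Function.update z kv c) F₁₁ = eval z F₁₁)
    (hst : F = 0 ∨ IsUpperHalfPlaneStable F) :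
    D = 0 ∨ IsUpperHalfPlaneStable D := by
  have hFu : ∀ z u, eval (Function.update z kw u) F = eval z P + u * eval z Q := fun z u => by
    rw [hF, hPw, hQw, Function.update_self]
  have hQu : ∀ z u, eval (Function.update z kv u) Q = f₁₀ z + u * eval z F₁₁ := fun z u => by
    rw [hQ, hf₁₀v, hF₁₁v, Function.update_self]
  have hPu : ∀ z u, eval (Function.update z kv u) P = f₀₀ z + u * f₀₁ z := fun z u => by
    rw [hP, hf₀₀v, hf₀₁v, Function.update_self]
  -- moving one coordinate inside `H^τ`
  have hupd : ∀ z : τ → ℂ, (∀ i, 0 < (z i).im) → ∀ (k : τ) (u : ℂ), 0 < u.im →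
      ∀ i, 0 < (Function.update z k u i).im := by
    intro z hz k u hu i
    rcases eq_or_ne i k with rfl | hi
    · simpa using hu
    · rw [Function.update_of_ne hi]
      exact hz i
  -- `F₁₁` vanishes identically once `Q` does
  have hF₁₁_of_Q : (∀ z, eval z Q = 0) → ∀ z, eval z F₁₁ = 0 := fun hQ0 z => by
    have h0 := hQu z 0
    have h1 := hQu z 1
    rw [hQ0] at h0 h1
    linear_combination h0 - h1
  rcases hst with hF0 | hFst
  · -- the degenerate case `F = 0`: everything vanishes
    left
    have hP0 : ∀ z, eval z P = 0 := fun z => by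
      have h := hFu z 0
      rw [hF0, map_zero] at h
      linear_combination -h
    have hQ0 : ∀ z, eval z Q = 0 := fun z => by
      have h := hFu z 1
      rw [hF0, map_zero, hP0] at h
      linear_combination -h
    have hf₀₀0 : ∀ z, f₀₀ z = 0 := fun z => by
      have h := hPu z 0
      rw [hP0] at h
      linear_combination -h
    refine MvPolynomial.funext fun z => ?_
    rw [hD, hf₀₀0, hF₁₁_of_Q hQ0, map_zero, sub_zero]
  -- Step 1: `Q` is `0` or stable — specialise `z_{kw} := 0` in the stable `Q - z_{kw} P`
  have hQst : Q = 0 ∨ IsUpperHalfPlaneStable Q := by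
    refine eq_zero_or_stable_of_eval_update_zero (G := Q - X kw * P) kw (Or.inr ?_) fun z => ?_
    · intro z hz h0
      rw [map_sub, map_mul, eval_X] at h0
      have hne : z kw ≠ 0 := fun h => by
        have := hz kw
        rw [h] at this
        simp at this
      refine hFst _ (hupd z hz kw _ (neg_inv_im_pos (hz kw))) ?_
      rw [hFu]
      calc eval z P + -(z kw)⁻¹ * eval z Q = -(z kw)⁻¹ * (eval z Q - z kw * eval z P) := by
            field_simp
            ring
        _ = 0 := by rw [h0, mul_zero]
    · rw [map_sub, map_mul, eval_X, Function.update_self, zero_mul, sub_zero, hQw]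
  rcases hQst with hQ0 | hQst
  · -- Step 2: `Q = 0`: then `D = F|_{z_{kv} := 0}`
    have hQ0' : ∀ z, eval z Q = 0 := fun z => by rw [hQ0, map_zero]
    refine eq_zero_or_stable_of_eval_update_zero (G := F) kv (Or.inr hFst) fun z => ?_
    rw [hF, hQ0', mul_zero, add_zero, hPu, zero_mul, add_zero, hD, hF₁₁_of_Q hQ0', sub_zero]
  -- Step 3: `Q` stable: `(P - F₁₁) + z_{kw} Q` is stable (two nonnegative imaginary parts)
  have h3 : IsUpperHalfPlaneStable (P - F₁₁ + X kw * Q) := by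
    intro z hz
    rw [map_add, map_sub, map_mul, eval_X]
    have hQz : eval z Q ≠ 0 := hQst z hz
    have h1 : 0 ≤ (eval z P / eval z Q).im :=
      im_div_nonneg_of_forall_ne_zero hQz fun u hu => by
        rw [← hFu]
        exact hFst _ (hupd z hz kw u hu)
    have h2 : 0 ≤ (-eval z F₁₁ / eval z Q).im := by
      refine im_div_nonneg_of_forall_ne_zero hQz fun u hu h => ?_
      have hne : u ≠ 0 := by
        rintro rfl
        simp at hu
      have hz' : ∀ j, 0 < (Function.update z kv (z kv - u⁻¹) j).im := by
        refine hupd z hz kv _ ?_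
        have := neg_inv_im_pos hu
        rw [Complex.neg_im] at this
        rw [Complex.sub_im]
        linarith [hz kv]
      refine hQst _ hz' ?_
      rw [hQu]
      calc f₁₀ z + (z kv - u⁻¹) * eval z F₁₁ = u⁻¹ * (-eval z F₁₁ + u * eval z Q) := by
            rw [hQ]
            field_simp
            ring
        _ = 0 := by rw [h, mul_zero]
    have h12 : 0 ≤ ((eval z P - eval z F₁₁) / eval z Q).im := by
      have : (eval z P - eval z F₁₁) / eval z Q = eval z P / eval z Q + -eval z F₁₁ / eval z Q := by
        ring
      rw [this, Complex.add_im]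
      exact add_nonneg h1 h2
    exact add_mul_ne_zero_of_im_div_nonneg hQz h12 (hz kw)
  -- Step 4: specialise `z_{kw} := 0`
  have h4 : P - F₁₁ = 0 ∨ IsUpperHalfPlaneStable (P - F₁₁) :=
    eq_zero_or_stable_of_eval_update_zero (G := P - F₁₁ + X kw * Q) kw (Or.inr h3) fun z => by
      rw [map_add, map_mul, eval_X, Function.update_self, zero_mul, add_zero, map_sub, map_sub, hPw,
        hF₁₁w]
  -- Step 5: specialise `z_{kv} := 0`
  exact eq_zero_or_stable_of_eval_update_zero (G := P - F₁₁) kv h4 fun z => by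
    rw [map_sub, hPu, zero_mul, add_zero, hF₁₁v, hD]

end Contraction

section Sufficiency

variable [Fintype σ] [DecidableEq σ]

omit [Fintype σ] in
/-- The `z`-block copy of a polynomial (variables `Sum.inl ∘ Sum.inl` among `(z, w, v)`) does not
see updates of the other coordinates. [folklore] -/
theorem eval_update_rename_inl_inl (g : MvPolynomial σ ℂ) (z : (σ ⊕ σ) ⊕ σ → ℂ)
    (k : (σ ⊕ σ) ⊕ σ) (hk : ∀ j, Sum.inl (Sum.inl j) ≠ k) (c : ℂ) :
    eval (Function.update z k c) (rename (Sum.inl ∘ Sum.inl) g) =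
      eval z (rename (Sum.inl ∘ Sum.inl) g) := by
  rw [eval_rename, eval_rename]
  exact congrArg (fun y => eval y g) (funext fun j => Function.update_of_ne (hk j) _ _)

omit [Fintype σ] [DecidableEq σ] in
/-- Index bookkeeping for the contraction: `S ∩ (I ∪ {i}) = R ∩ (I ∪ {i})` iff
`S ∩ I = R ∩ I` and `i ∈ S ↔ i ∈ R`. [folklore] -/
theorem inter_insert_eq_inter_insert_iff [DecidableEq σ] {S R I : Finset σ} {i : σ} :
    S ∩ insert i I = R ∩ insert i I ↔ S ∩ I = R ∩ I ∧ (i ∈ S ↔ i ∈ R) := by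
  simp only [Finset.ext_iff, Finset.mem_inter, Finset.mem_insert]
  constructor
  · intro h
    refine ⟨fun j => ⟨fun hj => ⟨((h j).1 ⟨hj.1, Or.inr hj.2⟩).1, hj.2⟩,
      fun hj => ⟨((h j).2 ⟨hj.1, Or.inr hj.2⟩).1, hj.2⟩⟩, ?_⟩
    exact ⟨fun hi => ((h i).1 ⟨hi, Or.inl rfl⟩).1, fun hi => ((h i).2 ⟨hi, Or.inl rfl⟩).1⟩
  · rintro ⟨h, hi⟩ j
    rcases eq_or_ne j i with rfl | hji
    · simp [hi]
    · constructor
      · rintro ⟨hjS, hj⟩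
        have hjI : j ∈ I := hj.resolve_left hji
        exact ⟨((h j).1 ⟨hjS, hjI⟩).1, Or.inr hjI⟩
      · rintro ⟨hjR, hj⟩
        have hjI : j ∈ I := hj.resolve_left hji
        exact ⟨((h j).2 ⟨hjR, hjI⟩).1, Or.inr hjI⟩

/-- **The contraction induction** (the "repeated use of Lieb–Sokal's Lemma" in the proof of
Borcea–Brändén 2009, Lemma 2.2, organised with the inversion `v ↦ -1/v` of Lemma 1.7 (3) in place
of derivatives). In the `3n` variables `(z, w, v)` (index type `(σ ⊕ σ) ⊕ σ`) put
`Ψ_I = Σ_{S ∩ I = R ∩ I} (-1)^{|I∖S|+|R|} a(R) · T[z^S] · w^{Iᶜ∖S} · v^{Iᶜ∖R}`. Then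
`Ψ_∅ = G_T(z,w) · v^{[n]} f(-1/v)` is stable (`f = Σ a(R) z^R` stable, `G_T` stable), and
`Ψ_{I ∪ {i}}` is the Lieb–Sokal contraction of `Ψ_I` in the pair `(wᵢ, vᵢ)`; hence every `Ψ_I` is
`0` or stable. [cite: BorceaBranden2009, §2.1, Lemma 2.2 and its proof] -/
theorem contractionStage_eq_zero_or_stable (T : MvPolynomial σ ℂ →ₗ[ℂ] MvPolynomial σ ℂ)
    (hG : IsUpperHalfPlaneStable (multiAffineSymbol T)) {a : Finset σ → ℂ}
    (ha : IsUpperHalfPlaneStable (multiAffine a)) (I : Finset σ) :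
    (∑ x ∈ Finset.univ.filter (fun x : Finset σ × Finset σ => x.1 ∩ I = x.2 ∩ I),
        C ((-1) ^ ((I \ x.1).card + x.2.card) * a x.2) *
          (rename (Sum.inl ∘ Sum.inl) (T (∏ i ∈ x.1, X i)) *
            ((∏ j ∈ Iᶜ \ x.1, X (Sum.inl (Sum.inr j))) * ∏ j ∈ Iᶜ \ x.2, X (Sum.inr j))) :
        MvPolynomial ((σ ⊕ σ) ⊕ σ) ℂ) = 0 ∨
      IsUpperHalfPlaneStable
        (∑ x ∈ Finset.univ.filter (fun x : Finset σ × Finset σ => x.1 ∩ I = x.2 ∩ I),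
          C ((-1) ^ ((I \ x.1).card + x.2.card) * a x.2) *
            (rename (Sum.inl ∘ Sum.inl) (T (∏ i ∈ x.1, X i)) *
              ((∏ j ∈ Iᶜ \ x.1, X (Sum.inl (Sum.inr j))) * ∏ j ∈ Iᶜ \ x.2, X (Sum.inr j))) :
          MvPolynomial ((σ ⊕ σ) ⊕ σ) ℂ) := by
  induction I using Finset.induction_on with
  | empty =>
    -- `Ψ_∅ (z, w, v) = G_T(z, w) · Σ_R (-1)^{|R|} a(R) v^{Rᶜ}`, a product of two nonzero numbers
    right
    intro z hz
    simp only [map_sum, map_mul, eval_C, map_prod, eval_X]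
    have hfilt : Finset.univ.filter (fun x : Finset σ × Finset σ => x.1 ∩ ∅ = x.2 ∩ ∅) =
        Finset.univ := Finset.filter_true_of_mem fun x _ => by simp
    rw [hfilt]
    simp only [Finset.empty_sdiff, Finset.card_empty, zero_add, Finset.compl_empty,
      ← Finset.compl_eq_univ_sdiff]
    have hsym : eval (fun k => z (Sum.inl k)) (multiAffineSymbol T) =
        ∑ S : Finset σ, eval z (rename (Sum.inl ∘ Sum.inl) (T (∏ i ∈ S, X i))) *
          ∏ j ∈ Sᶜ, z (Sum.inl (Sum.inr j)) := by
      simp only [multiAffineSymbol, map_sum, map_mul, eval_rename, map_prod, eval_X]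
      rfl
    have hprod : (∑ x : Finset σ × Finset σ, (-1) ^ x.2.card * a x.2 *
        (eval z (rename (Sum.inl ∘ Sum.inl) (T (∏ i ∈ x.1, X i))) *
          ((∏ j ∈ x.1ᶜ, z (Sum.inl (Sum.inr j))) * ∏ j ∈ x.2ᶜ, z (Sum.inr j)))) =
        (∑ S : Finset σ, eval z (rename (Sum.inl ∘ Sum.inl) (T (∏ i ∈ S, X i))) *
            ∏ j ∈ Sᶜ, z (Sum.inl (Sum.inr j))) *
          ∑ R : Finset σ, (-1) ^ R.card * a R * ∏ j ∈ Rᶜ, z (Sum.inr j) := by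
      rw [Finset.sum_mul_sum, ← Finset.univ_product_univ, Finset.sum_product]
      refine Finset.sum_congr rfl fun S _ => Finset.sum_congr rfl fun R _ => ?_
      ring
    rw [hprod, ← hsym]
    refine mul_ne_zero (hG _ fun k => hz _) ?_
    -- the inversion `v ↦ -1/v` (Borcea–Brändén Lemma 1.7 (3))
    have hv : ∀ j, z (Sum.inr j) ≠ 0 := fun j h => by
      have := hz (Sum.inr j)
      rw [h] at this
      simp at this
    have h1 : ∀ j, z (Sum.inr j) * -(z (Sum.inr j))⁻¹ = -1 := fun j => by
      rw [mul_neg, mul_inv_cancel₀ (hv j)]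
    have hinv : (∑ R : Finset σ, (-1) ^ R.card * a R * ∏ j ∈ Rᶜ, z (Sum.inr j)) =
        (∏ j, z (Sum.inr j)) * eval (fun j => -(z (Sum.inr j))⁻¹) (multiAffine a) := by
      rw [eval_multiAffine, Finset.mul_sum]
      refine Finset.sum_congr rfl fun R _ => ?_
      rw [← Finset.prod_mul_prod_compl R fun j => z (Sum.inr j)]
      calc (-1) ^ R.card * a R * ∏ j ∈ Rᶜ, z (Sum.inr j)
          = (∏ j ∈ R, (z (Sum.inr j) * -(z (Sum.inr j))⁻¹)) * a R * ∏ j ∈ Rᶜ, z (Sum.inr j) := by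
            rw [Finset.prod_congr rfl fun j _ => h1 j, Finset.prod_const]
        _ = (∏ j ∈ R, z (Sum.inr j)) * (∏ j ∈ Rᶜ, z (Sum.inr j)) *
              (a R * ∏ i ∈ R, -(z (Sum.inr i))⁻¹) := by
            rw [Finset.prod_mul_distrib]
            ring
    rw [hinv]
    exact mul_ne_zero (Finset.prod_ne_zero_iff.2 fun j _ => hv j)
      (ha _ fun j => neg_inv_im_pos (hz _))
  | insert i I hiI ih =>
    -- the contraction in the pair `(wᵢ, vᵢ)`
    refine lieb_sokal_contraction (kw := Sum.inl (Sum.inr i)) (kv := Sum.inr i)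
      (P := ∑ x ∈ (Finset.univ.filter (fun x : Finset σ × Finset σ => x.1 ∩ I = x.2 ∩ I)).filter
          (fun x => i ∈ x.1),
        C ((-1) ^ ((I \ x.1).card + x.2.card) * a x.2) *
          (rename (Sum.inl ∘ Sum.inl) (T (∏ i ∈ x.1, X i)) *
            ((∏ j ∈ Iᶜ \ x.1, X (Sum.inl (Sum.inr j))) * ∏ j ∈ Iᶜ \ x.2, X (Sum.inr j))))
      (Q := ∑ x ∈ (Finset.univ.filter (fun x : Finset σ × Finset σ => x.1 ∩ I = x.2 ∩ I)).filter
          (fun x => i ∉ x.1),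
        C ((-1) ^ ((I \ x.1).card + x.2.card) * a x.2) *
          (rename (Sum.inl ∘ Sum.inl) (T (∏ i ∈ x.1, X i)) *
            ((∏ j ∈ (Iᶜ \ x.1).erase i, X (Sum.inl (Sum.inr j))) * ∏ j ∈ Iᶜ \ x.2, X (Sum.inr j))))
      (F₁₁ := ∑ x ∈ ((Finset.univ.filter (fun x : Finset σ × Finset σ => x.1 ∩ I = x.2 ∩ I)).filter
          (fun x => i ∉ x.1)).filter (fun x => i ∉ x.2),
        C ((-1) ^ ((I \ x.1).card + x.2.card) * a x.2) *
          (rename (Sum.inl ∘ Sum.inl) (T (∏ i ∈ x.1, X i)) *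
            ((∏ j ∈ (Iᶜ \ x.1).erase i, X (Sum.inl (Sum.inr j))) *
              ∏ j ∈ (Iᶜ \ x.2).erase i, X (Sum.inr j))))
      (f₀₀ := fun z => ∑ x ∈ ((Finset.univ.filter
          (fun x : Finset σ × Finset σ => x.1 ∩ I = x.2 ∩ I)).filter (fun x => i ∈ x.1)).filter
            (fun x => i ∈ x.2),
        (-1) ^ ((I \ x.1).card + x.2.card) * a x.2 *
          (eval z (rename (Sum.inl ∘ Sum.inl) (T (∏ i ∈ x.1, X i))) *
            ((∏ j ∈ Iᶜ \ x.1, z (Sum.inl (Sum.inr j))) * ∏ j ∈ Iᶜ \ x.2, z (Sum.inr j))))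
      (f₀₁ := fun z => ∑ x ∈ ((Finset.univ.filter
          (fun x : Finset σ × Finset σ => x.1 ∩ I = x.2 ∩ I)).filter (fun x => i ∈ x.1)).filter
            (fun x => i ∉ x.2),
        (-1) ^ ((I \ x.1).card + x.2.card) * a x.2 *
          (eval z (rename (Sum.inl ∘ Sum.inl) (T (∏ i ∈ x.1, X i))) *
            ((∏ j ∈ Iᶜ \ x.1, z (Sum.inl (Sum.inr j))) * ∏ j ∈ (Iᶜ \ x.2).erase i, z (Sum.inr j))))
      (f₁₀ := fun z => ∑ x ∈ ((Finset.univ.filter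
          (fun x : Finset σ × Finset σ => x.1 ∩ I = x.2 ∩ I)).filter (fun x => i ∉ x.1)).filter
            (fun x => i ∈ x.2),
        (-1) ^ ((I \ x.1).card + x.2.card) * a x.2 *
          (eval z (rename (Sum.inl ∘ Sum.inl) (T (∏ i ∈ x.1, X i))) *
            ((∏ j ∈ (Iᶜ \ x.1).erase i, z (Sum.inl (Sum.inr j))) * ∏ j ∈ Iᶜ \ x.2, z (Sum.inr j))))
      ?_ ?_ ?_ ?_ ?_ ?_ ?_ ?_ ?_ ?_ ?_ ih
    · -- `Ψ_I = P + wᵢ Q`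
      intro z
      simp only [map_sum, map_mul, eval_C, map_prod, eval_X]
      rw [← Finset.sum_filter_add_sum_filter_not _ (fun x : Finset σ × Finset σ => i ∈ x.1),
        Finset.mul_sum]
      congr 1
      refine Finset.sum_congr rfl fun x hx => ?_
      simp only [Finset.mem_filter, Finset.mem_univ, true_and] at hx
      have hmem : i ∈ Iᶜ \ x.1 := by simp [hx.2, hiI]
      rw [← Finset.mul_prod_erase _ (fun j => z (Sum.inl (Sum.inr j))) hmem]
      ring
    · -- `P = f₀₀ + vᵢ f₀₁`
      intro z
      simp only [map_sum, map_mul, eval_C, map_prod, eval_X]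
      rw [← Finset.sum_filter_add_sum_filter_not _ (fun x : Finset σ × Finset σ => i ∈ x.2),
        Finset.mul_sum]
      congr 1
      refine Finset.sum_congr rfl fun x hx => ?_
      simp only [Finset.mem_filter, Finset.mem_univ, true_and] at hx
      have hmem : i ∈ Iᶜ \ x.2 := by simp [hx.2, hiI]
      rw [← Finset.mul_prod_erase _ (fun j => z (Sum.inr j)) hmem]
      ring
    · -- `Q = f₁₀ + vᵢ F₁₁`
      intro z
      simp only [map_sum, map_mul, eval_C, map_prod, eval_X]
      rw [← Finset.sum_filter_add_sum_filter_not _ (fun x : Finset σ × Finset σ => i ∈ x.2),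
        Finset.mul_sum]
      congr 1
      refine Finset.sum_congr rfl fun x hx => ?_
      simp only [Finset.mem_filter, Finset.mem_univ, true_and] at hx
      have hmem : i ∈ Iᶜ \ x.2 := by simp [hx.2, hiI]
      rw [← Finset.mul_prod_erase _ (fun j => z (Sum.inr j)) hmem]
      ring
    · -- `Ψ_{I ∪ {i}} = f₀₀ - F₁₁`
      intro z
      simp only [map_sum, map_mul, eval_C, map_prod, eval_X]
      have hfilt : Finset.univ.filter
            (fun x : Finset σ × Finset σ => x.1 ∩ insert i I = x.2 ∩ insert i I) =
          (Finset.univ.filter (fun x : Finset σ × Finset σ => x.1 ∩ I = x.2 ∩ I)).filter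
            (fun x => (i ∈ x.1 ↔ i ∈ x.2)) := by
        rw [Finset.filter_filter]
        exact Finset.filter_congr fun x _ => inter_insert_eq_inter_insert_iff
      have hA : ((Finset.univ.filter (fun x : Finset σ × Finset σ => x.1 ∩ I = x.2 ∩ I)).filter
            (fun x => (i ∈ x.1 ↔ i ∈ x.2))).filter (fun x => i ∈ x.1) =
          ((Finset.univ.filter (fun x : Finset σ × Finset σ => x.1 ∩ I = x.2 ∩ I)).filter
            (fun x => i ∈ x.1)).filter (fun x => i ∈ x.2) := by
        simp only [Finset.filter_filter]
        exact Finset.filter_congr fun x _ => by tauto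
      have hB : ((Finset.univ.filter (fun x : Finset σ × Finset σ => x.1 ∩ I = x.2 ∩ I)).filter
            (fun x => (i ∈ x.1 ↔ i ∈ x.2))).filter (fun x => ¬ i ∈ x.1) =
          ((Finset.univ.filter (fun x : Finset σ × Finset σ => x.1 ∩ I = x.2 ∩ I)).filter
            (fun x => i ∉ x.1)).filter (fun x => i ∉ x.2) := by
        simp only [Finset.filter_filter]
        exact Finset.filter_congr fun x _ => by tauto
      rw [hfilt, ← Finset.sum_filter_add_sum_filter_not _ (fun x : Finset σ × Finset σ => i ∈ x.1),
        hA, hB, sub_eq_add_neg, ← Finset.sum_neg_distrib]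
      congr 1
      · refine Finset.sum_congr rfl fun x hx => ?_
        simp only [Finset.mem_filter, Finset.mem_univ, true_and] at hx
        rw [Finset.insert_sdiff_of_mem _ hx.1.2, Finset.compl_insert, Finset.erase_sdiff_comm,
          Finset.erase_sdiff_comm, Finset.erase_eq_of_notMem (s := Iᶜ \ x.1) (a := i) (by simp [hx.1.2]),
          Finset.erase_eq_of_notMem (s := Iᶜ \ x.2) (a := i) (by simp [hx.2])]
      · refine Finset.sum_congr rfl fun x hx => ?_
        simp only [Finset.mem_filter, Finset.mem_univ, true_and] at hx
        rw [Finset.insert_sdiff_of_notMem _ hx.1.2,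
          Finset.card_insert_of_notMem (by simp [hiI] : i ∉ I \ x.1), Finset.compl_insert,
          Finset.erase_sdiff_comm, Finset.erase_sdiff_comm]
        ring
    · -- `P` does not involve `wᵢ`
      intro z c
      simp only [map_sum, map_mul, eval_C, map_prod, eval_X]
      refine Finset.sum_congr rfl fun x hx => ?_
      simp only [Finset.mem_filter, Finset.mem_univ, true_and] at hx
      rw [eval_update_rename_inl_inl _ _ _ (fun j => by simp)]
      congr 3
      exact Finset.prod_congr rfl fun j hj => Function.update_of_ne
        (by simpa using (ne_of_mem_of_not_mem hx.2 (Finset.mem_sdiff.1 hj).2).symm) _ _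
    · -- `Q` does not involve `wᵢ`
      intro z c
      simp only [map_sum, map_mul, eval_C, map_prod, eval_X]
      refine Finset.sum_congr rfl fun x _ => ?_
      rw [eval_update_rename_inl_inl _ _ _ (fun j => by simp)]
      congr 3
      exact Finset.prod_congr rfl fun j hj => Function.update_of_ne
        (by simpa using (Finset.mem_erase.1 hj).1) _ _
    · -- `F₁₁` does not involve `wᵢ`
      intro z c
      simp only [map_sum, map_mul, eval_C, map_prod, eval_X]
      refine Finset.sum_congr rfl fun x _ => ?_
      rw [eval_update_rename_inl_inl _ _ _ (fun j => by simp)]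
      congr 3
      exact Finset.prod_congr rfl fun j hj => Function.update_of_ne
        (by simpa using (Finset.mem_erase.1 hj).1) _ _
    · -- `f₀₀` does not involve `vᵢ`
      intro z c
      refine Finset.sum_congr rfl fun x hx => ?_
      simp only [Finset.mem_filter, Finset.mem_univ, true_and] at hx
      rw [eval_update_rename_inl_inl _ _ _ (fun j => by simp)]
      congr 3
      exact Finset.prod_congr rfl fun j hj => Function.update_of_ne
        (by simpa using (ne_of_mem_of_not_mem hx.2 (Finset.mem_sdiff.1 hj).2).symm) _ _
    · -- `f₀₁` does not involve `vᵢ`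
      intro z c
      refine Finset.sum_congr rfl fun x _ => ?_
      rw [eval_update_rename_inl_inl _ _ _ (fun j => by simp)]
      congr 3
      exact Finset.prod_congr rfl fun j hj => Function.update_of_ne
        (by simpa using (Finset.mem_erase.1 hj).1) _ _
    · -- `f₁₀` does not involve `vᵢ`
      intro z c
      refine Finset.sum_congr rfl fun x hx => ?_
      simp only [Finset.mem_filter, Finset.mem_univ, true_and] at hx
      rw [eval_update_rename_inl_inl _ _ _ (fun j => by simp)]
      congr 3
      exact Finset.prod_congr rfl fun j hj => Function.update_of_ne
        (by simpa using (ne_of_mem_of_not_mem hx.2 (Finset.mem_sdiff.1 hj).2).symm) _ _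
    · -- `F₁₁` does not involve `vᵢ`
      intro z c
      simp only [map_sum, map_mul, eval_C, map_prod, eval_X]
      refine Finset.sum_congr rfl fun x _ => ?_
      rw [eval_update_rename_inl_inl _ _ _ (fun j => by simp)]
      congr 3
      exact Finset.prod_congr rfl fun j hj => Function.update_of_ne
        (by simpa using (Finset.mem_erase.1 hj).1) _ _

/-- **Borcea–Brändén 2009, Lemma 2.2, coefficient form**: if the symbol `G_T` is stable and
`f = Σ_S a(S) z^S` is stable, then `T f` is stable or `0`. From the contraction induction at
`I = [n]`: `Ψ_{[n]} = (-1)ⁿ T(f)(z)`. [cite: BorceaBranden2009, §2.1, Lemma 2.2] -/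
theorem multiAffineSymbol_stable_apply_multiAffine (T : MvPolynomial σ ℂ →ₗ[ℂ] MvPolynomial σ ℂ)
    (hG : IsUpperHalfPlaneStable (multiAffineSymbol T)) {a : Finset σ → ℂ}
    (ha : IsUpperHalfPlaneStable (multiAffine a)) :
    IsUpperHalfPlaneStable (T (multiAffine a)) ∨ T (multiAffine a) = 0 := by
  have key := contractionStage_eq_zero_or_stable T hG ha Finset.univ
  have hval : ∀ z : (σ ⊕ σ) ⊕ σ → ℂ,
      eval z (∑ x ∈ Finset.univ.filter
          (fun x : Finset σ × Finset σ => x.1 ∩ Finset.univ = x.2 ∩ Finset.univ),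
        C ((-1) ^ ((Finset.univ \ x.1).card + x.2.card) * a x.2) *
          (rename (Sum.inl ∘ Sum.inl) (T (∏ i ∈ x.1, X i)) *
            ((∏ j ∈ Finset.univᶜ \ x.1, X (Sum.inl (Sum.inr j))) *
              ∏ j ∈ Finset.univᶜ \ x.2, X (Sum.inr j))) : MvPolynomial ((σ ⊕ σ) ⊕ σ) ℂ) =
        (-1) ^ Fintype.card σ * eval (fun i => z (Sum.inl (Sum.inl i))) (T (multiAffine a)) := by
    intro z
    simp only [map_sum, map_mul, eval_C, map_prod, eval_X]
    have hfilt : Finset.univ.filter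
          (fun x : Finset σ × Finset σ => x.1 ∩ Finset.univ = x.2 ∩ Finset.univ) =
        Finset.univ.filter (fun x : Finset σ × Finset σ => x.1 = x.2) :=
      Finset.filter_congr fun x _ => by simp
    rw [hfilt, Finset.sum_filter, Fintype.sum_prod_type]
    simp only [Finset.sum_ite_eq, Finset.mem_univ, if_true, Finset.compl_univ, Finset.empty_sdiff,
      Finset.prod_empty, mul_one, ← Finset.compl_eq_univ_sdiff]
    have hT : eval (fun i => z (Sum.inl (Sum.inl i))) (T (multiAffine a)) =
        ∑ S : Finset σ, a S * eval z (rename (Sum.inl ∘ Sum.inl) (T (∏ i ∈ S, X i))) := by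
      simp only [multiAffine, C_mul', map_sum, map_smul, smul_eval, eval_rename]
      rfl
    rw [hT, Finset.mul_sum]
    refine Finset.sum_congr rfl fun S _ => ?_
    rw [show Sᶜ.card + S.card = Fintype.card σ by rw [add_comm, Finset.card_add_card_compl]]
    ring
  rcases key with h0 | hst
  · right
    refine MvPolynomial.funext fun y => ?_
    have := hval (Sum.elim (Sum.elim y y) y)
    rw [h0, map_zero] at this
    have h1 : ((-1 : ℂ) ^ Fintype.card σ) ≠ 0 := pow_ne_zero _ (neg_ne_zero.2 one_ne_zero)
    have := (mul_eq_zero.1 this.symm).resolve_left h1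
    simpa using this
  · left
    intro y hy h0
    have hz : ∀ k, 0 < ((Sum.elim (Sum.elim y y) y : (σ ⊕ σ) ⊕ σ → ℂ) k).im := by
      rintro ((k | k) | k) <;> exact hy k
    refine hst _ hz ?_
    rw [hval]
    simp [h0]

/-! ### Coefficient form of multi-affine polynomials and the main theorem -/

omit [Fintype σ] in
/-- `z^S = ∏_{i ∈ S} zᵢ` is the monomial with exponent vector `𝟙_S`. [folklore] -/
theorem prod_X_eq_monomial (S : Finset σ) :
    (∏ i ∈ S, X i : MvPolynomial σ ℂ) = monomial (∑ i ∈ S, Finsupp.single i 1) 1 := by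
  induction S using Finset.induction_on with
  | empty => rw [Finset.prod_empty, Finset.sum_empty]; rfl
  | insert i S hi ih =>
    rw [Finset.prod_insert hi, Finset.sum_insert hi, ih, monomial_single_add, pow_one]

omit [Fintype σ] in
/-- The exponent vector `𝟙_S` evaluated. [folklore] -/
theorem sum_single_one_apply (S : Finset σ) (j : σ) :
    (∑ i ∈ S, Finsupp.single i 1 : σ →₀ ℕ) j = if j ∈ S then 1 else 0 := by
  rw [Finsupp.finsetSum_apply]
  simp only [Finsupp.single_apply]
  rw [Finset.sum_ite_eq']

/-- **Coefficient form**: a multi-affine polynomial is `Σ_S a(S) z^S` with `a(S)` its coefficient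
of `z^S` (Borcea–Brändén 2009, §2.1: "`f` is multi-affine if … `f(z) = Σ_{S ⊆ [n]} a(S) z^S`").
[cite: BorceaBranden2009, §2.1] -/
theorem eq_multiAffine_of_isMultiAffine {f : MvPolynomial σ ℂ} (hf : IsMultiAffine f) :
    f = multiAffine fun S => coeff (∑ i ∈ S, Finsupp.single i 1) f := by
  have hinj : Function.Injective (fun S : Finset σ => (∑ i ∈ S, Finsupp.single i 1 : σ →₀ ℕ)) := by
    intro S R h
    ext j
    have := congrArg (fun m : σ →₀ ℕ => m j) h
    simp only [sum_single_one_apply] at this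
    by_cases hS : j ∈ S <;> by_cases hR : j ∈ R <;> simp_all
  have hsupp : ∀ m ∈ f.support, (∑ i ∈ m.support, Finsupp.single i 1 : σ →₀ ℕ) = m := by
    intro m hm
    ext j
    rw [sum_single_one_apply]
    split_ifs with h
    · exact (le_antisymm ((isMultiAffine_iff_support f).1 hf m hm j)
        (Nat.one_le_iff_ne_zero.2 (Finsupp.mem_support_iff.1 h))).symm
    · exact (Finsupp.notMem_support_iff.1 h).symm
  conv_lhs => rw [f.as_sum]
  calc ∑ m ∈ f.support, monomial m (coeff m f)
      = ∑ m ∈ Finset.univ.image (fun S : Finset σ => (∑ i ∈ S, Finsupp.single i 1 : σ →₀ ℕ)),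
          monomial m (coeff m f) := by
        apply Finset.sum_subset
        · intro m hm
          exact Finset.mem_image.2 ⟨m.support, Finset.mem_univ _, hsupp m hm⟩
        · intro m _ hm
          rw [notMem_support_iff.1 hm, map_zero]
    _ = ∑ S : Finset σ, monomial (∑ i ∈ S, Finsupp.single i 1) (coeff (∑ i ∈ S, Finsupp.single i 1) f) :=
        Finset.sum_image fun S _ R _ h => hinj h
    _ = multiAffine fun S => coeff (∑ i ∈ S, Finsupp.single i 1) f := by
        simp only [multiAffine, prod_X_eq_monomial, C_mul_monomial, mul_one]

/-- **Borcea–Brändén 2009, Lemma 2.2** (sufficiency of the symbol criterion, multi-affine case),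
now unconditional: if `G_T` is stable then `T f` is stable or `0` for every stable multi-affine
`f`. [cite: BorceaBranden2009, §2.1, Lemma 2.2] -/
theorem multiAffine_stabilityPreserver_sufficiency (T : MvPolynomial σ ℂ →ₗ[ℂ] MvPolynomial σ ℂ)
    (hG : IsUpperHalfPlaneStable (multiAffineSymbol T)) {f : MvPolynomial σ ℂ}
    (hf : IsMultiAffine f) (hs : IsUpperHalfPlaneStable f) :
    IsUpperHalfPlaneStable (T f) ∨ T f = 0 := by
  rw [eq_multiAffine_of_isMultiAffine hf] at hs ⊢
  exact multiAffineSymbol_stable_apply_multiAffine T hG hs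

end Sufficiency

/-- **Borcea–Brändén 2009, Theorem 1.1 for multi-affine polynomials** (discharge of the named fact
`BorceaBranden2009_multiAffine_stabilityPreserver_iff` of `Basic.lean`): a linear operator `T`,
regarded on the multi-affine polynomials in `n ≥ 1` variables, preserves stability iff
(a) `T = α(·) P` with `P` stable, or (b) its symbol `G_T(z, w) = Σ_S T[z^S] w^{[n]∖S}` is
stable. Necessity: §3 of the paper (Lemma 3.1, Lemma 3.2 (ii)); sufficiency: Lemma 2.2 via the
Lieb–Sokal Lemma 2.1 and Lemma 1.7 (1) (the latter from `Limits.lean`).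
[cite: BorceaBranden2009, §1.1, Theorem 1.1 (case κ = (1,…,1)); §2.1, Lemmas 2.1–2.2; §3] -/
theorem BorceaBranden2009_multiAffine_stabilityPreserver_iff_holds :
    BorceaBranden2009_multiAffine_stabilityPreserver_iff := by
  intro σ _ _ _ T
  constructor
  · exact multiAffine_stabilityPreserver_necessity T
  · rintro (⟨α, P, hP, hαP⟩ | hG) f hf hs
    · rw [hαP f hf]
      by_cases h : α f = 0
      · right
        rw [h, zero_smul]
      · left
        rw [smul_eq_C_mul]
        exact (isUpperHalfPlaneStable_C h).mul hP
    · exact multiAffine_stabilityPreserver_sufficiency T hG hf hs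

end Literature.Combinatorics.StablePolynomials

end
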